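import Literature.AnabelianGeometry.SemiGraphs.CoveringFaithful
import Literature.AnabelianGeometry.SemiGraphs.CoveringEssSurj

/-!
# `toCovering A (reassembledOver D) ≅ D`: essential surjectivity and the equivalence `B(𝒢)_{/A} ≃ B(𝒢_A)` ([SemiAnbd] Def. 2.2 (i) — brick G7(b))

Mochizuki, *Semi-graphs of anabelioids*, Publ. RIMS **42** (2006) 221–322, §2 p. 23
[cite: MochizukiSemiAnbd2006, Def. 2.2(i) p.23].  For `D ∈ B(𝒢_A)` and the reassembled `X ∈ B(𝒢)_{/A}`
(`CoveringEssSurj.lean`): the piece `X_v ×_{S_v} P` IS `D_{(v,P)}` (`isIso_pieceVLift`, by the van Kampen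
property of finite coproducts in the extensive category `𝒢_v`), these identifications match the gluings
(`glue_reassembled`), whence `toCovering A X ≅ D` (`reassembledIso`), `toCovering A` is essentially
surjective and — with `CoveringFaithful`, `CoveringFull` — an equivalence (`toCovering_isEquivalence`).
-/

namespace Literature.AnabelianGeometry.SemiGraphs

namespace SemiGraphOfAnabelioids

open CategoryTheory CategoryTheory.Limits CategoryTheory.PreGaloisCategory
open Literature.AnabelianGeometry.Anabelioids

universe w' w v₁ u₁ u

-- Mathlib's `Over.pullback` / `Over.star` simp lemmas (`pullback.lift_fst`, …) only fire under the
-- pre-v4.2x defeq transparency behaviour, exactly as in `Mathlib/CategoryTheory/Comma/Over/Pullback.lean`.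
set_option backward.isDefEq.respectTransparency false

namespace BObj

variable {𝒢 : SemiGraphOfAnabelioids.{v₁, u₁, u}} (A : 𝒢.BObj) (D : A.coveringGraph.BObj)

/-! ### The pieces of the reassembled object are the pieces of `D` -/

/-- `D_{(v,P)} → X_v ×_{S_v} P`: the coproduct inclusion and the structure map.
[cite: MochizukiSemiAnbd2006, Def. 2.2(i) p.23] -/
noncomputable def pieceVLift (v : 𝒢.graph.Vertex) (c : Shrink.{u} (π₀Obj (A.S v))) :
    A.famV D v c ⟶ pullback ((Over.post (𝒢.ρ v)).obj (A.reassembledOver D)).hom (A.vComp ⟨v, c⟩).1.arrow :=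
  pullback.lift (Sigma.ι (A.famV D v) c) (A.famVHom D v c) (by
    change Sigma.ι (A.famV D v) c ≫ Sigma.desc _ = _
    rw [Sigma.ι_desc])

/-- **`X_v ×_{S_v} P = D_{(v,P)}`**: `pieceVLift` is an isomorphism — van Kampen for the two coproduct
decompositions `X_v = ∐ D_{(v,P)} = ∐ X_v ×_{S_v} P`. [cite: MochizukiSemiAnbd2006, Def. 2.2(i) p.23] -/
theorem isIso_pieceVLift (v : 𝒢.graph.Vertex) (c : Shrink.{u} (π₀Obj (A.S v))) : IsIso (A.pieceVLift D v c) := by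
  haveI := finitaryExtensive_of_galoisCategory (𝒢.V v)
  obtain ⟨hc₂⟩ := A.isColimit_cofan_vertices v ((Over.post (𝒢.ρ v)).obj (A.reassembledOver D)).hom
  have hvk := FinitaryExtensive.isVanKampen_finiteCoproducts hc₂
  have key := (hvk (Cofan.mk (((Over.post (𝒢.ρ v)).obj (A.reassembledOver D)).left) (fun j => Sigma.ι (A.famV D v) j))
    (Discrete.natTrans (fun j => A.pieceVLift D v j.as)) (𝟙 _) (by
      ext ⟨j⟩
      simp [pieceVLift])
    (NatTrans.Equifibered.of_discrete _)).mp ⟨coproductIsCoproduct _⟩ ⟨c⟩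
  exact key.isIso_snd_of_isIso
    (inst := by exact (inferInstance : IsIso (𝟙 (((Over.post (𝒢.ρ v)).obj (A.reassembledOver D)).left))))

/-- `D_{(v,P)} ≅ X_v ×_{S_v} P` over `P`. [cite: MochizukiSemiAnbd2006, Def. 2.2(i) p.23] -/
noncomputable def pieceVIso (v : 𝒢.graph.Vertex) (c : Shrink.{u} (π₀Obj (A.S v))) :
    A.pieceV D v c ≅ (A.toCoveringV ⟨v, c⟩).obj (A.reassembledOver D) :=
  haveI := A.isIso_pieceVLift D v c
  Over.isoMk (asIso (A.pieceVLift D v c)) (pullback.lift_snd _ _ _)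

/-- `D_{(e,Q)} → X_e ×_{T_e} Q`. [cite: MochizukiSemiAnbd2006, Def. 2.2(i) p.23] -/
noncomputable def pieceELift (e : 𝒢.graph.Edge) (c' : Shrink.{u} (π₀Obj (A.T e))) :
    A.famE D e c' ⟶ pullback ((Over.post (𝒢.ρE e)).obj (A.reassembledOver D)).hom (A.eComp ⟨e, c'⟩).1.arrow :=
  pullback.lift (Sigma.ι (A.famE D e) c') (A.pieceE D e c').hom (by
    change Sigma.ι (A.famE D e) c' ≫ Sigma.desc _ = _
    rw [Sigma.ι_desc])

/-- **`X_e ×_{T_e} Q = D_{(e,Q)}`.** [cite: MochizukiSemiAnbd2006, Def. 2.2(i) p.23] -/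
theorem isIso_pieceELift (e : 𝒢.graph.Edge) (c' : Shrink.{u} (π₀Obj (A.T e))) : IsIso (A.pieceELift D e c') := by
  haveI := finitaryExtensive_of_galoisCategory (𝒢.E e)
  obtain ⟨hc₂⟩ := A.isColimit_cofan_edges e ((Over.post (𝒢.ρE e)).obj (A.reassembledOver D)).hom
  have hvk := FinitaryExtensive.isVanKampen_finiteCoproducts hc₂
  have key := (hvk (Cofan.mk (((Over.post (𝒢.ρE e)).obj (A.reassembledOver D)).left) (fun j => Sigma.ι (A.famE D e) j))
    (Discrete.natTrans (fun j => A.pieceELift D e j.as)) (𝟙 _) (by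
      ext ⟨j⟩
      simp [pieceELift])
    (NatTrans.Equifibered.of_discrete _)).mp ⟨coproductIsCoproduct _⟩ ⟨c'⟩
  exact key.isIso_snd_of_isIso
    (inst := by exact (inferInstance : IsIso (𝟙 (((Over.post (𝒢.ρE e)).obj (A.reassembledOver D)).left))))

/-- `D_{(e,Q)} ≅ X_e ×_{T_e} Q` over `Q`. [cite: MochizukiSemiAnbd2006, Def. 2.2(i) p.23] -/
noncomputable def pieceEIso (e : 𝒢.graph.Edge) (c' : Shrink.{u} (π₀Obj (A.T e))) :
    A.pieceE D e c' ≅ (A.toCoveringE ⟨e, c'⟩).obj (A.reassembledOver D) :=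
  haveI := A.isIso_pieceELift D e c'
  Over.isoMk (asIso (A.pieceELift D e c')) (pullback.lift_snd _ _ _)

/-! ### Compatibility with the gluings -/

/-- **The piece identifications match the gluings**: transported along `D_{(v,σQ)} ≅ X_v ×_{S_v} σQ` and
`D_{(e,Q)} ≅ X_e ×_{T_e} Q`, the gluing isomorphism of `D` (read on the component anabelioids,
`pieceGlueIso`) is the pull-back-square gluing of `X` (`toCoveringGlueApp`) — because `ψ^X` was DEFINED as
the coproduct of the former. [cite: MochizukiSemiAnbd2006, Def. 2.2(i) p.23] -/
theorem glue_reassembled {b : 𝒢.graph.Branch} {v : 𝒢.graph.Vertex} (h : 𝒢.graph.abuts b = some v)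
    (c' : Shrink.{u} (π₀Obj (A.T (𝒢.graph.edgeOf b)))) :
    (A.gluingAt ⟨b, c'⟩ ⟨v, A.fibreData.σ b v h c'⟩ (A.total_abuts_mk h c')).map
        (A.pieceVIso D v (A.fibreData.σ b v h c')).hom ≫
      (A.toCoveringGlueApp ⟨b, c'⟩ ⟨v, A.fibreData.σ b v h c'⟩ (A.total_abuts_mk h c') (A.reassembledOver D)).hom =
      (A.pieceGlueIso D h c').hom ≫ (A.pieceEIso D (𝒢.graph.edgeOf b) c').hom := by
  ext
  apply pullback.hom_ext
  · rw [Over.comp_left, Over.comp_left, Category.assoc, Category.assoc, toCoveringGlueApp_hom_left_fst,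
      gluingAt_map_left_fst_assoc]
    have e₁ : (A.pieceEIso D (𝒢.graph.edgeOf b) c').hom.left ≫ pullback.fst _ _ = Sigma.ι (A.famE D _) c' := by
      change A.pieceELift D _ c' ≫ pullback.fst _ _ = _
      erw [pullback.lift_fst]
    have e₂ : (A.pieceVIso D v (A.fibreData.σ b v h c')).hom.left ≫ pullback.fst _ _ =
        Sigma.ι (A.famV D v) (A.fibreData.σ b v h c') := by
      change A.pieceVLift D v _ ≫ pullback.fst _ _ = _
      erw [pullback.lift_fst]
    erw [e₁, ← A.ι_glueψ_hom D h c', ← Functor.map_comp_assoc, e₂]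
    simp only [Category.assoc]
    erw [((Over.forget _).mapIso (A.pieceGlueIso D h c')).hom_inv_id_assoc]
    rfl
  · rw [Over.comp_left, Over.comp_left, Category.assoc, Category.assoc]
    erw [Over.w, Over.w, Over.w, Over.w]

/-- `glue_reassembled`, solved for the gluing of `X`. [cite: MochizukiSemiAnbd2006, Def. 2.2(i) p.23] -/
theorem glue_reassembled' {b : 𝒢.graph.Branch} {v : 𝒢.graph.Vertex} (h : 𝒢.graph.abuts b = some v)
    (c' : Shrink.{u} (π₀Obj (A.T (𝒢.graph.edgeOf b)))) :
    (A.toCoveringGlueApp ⟨b, c'⟩ ⟨v, A.fibreData.σ b v h c'⟩ (A.total_abuts_mk h c') (A.reassembledOver D)).hom ≫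
        (A.pieceEIso D (𝒢.graph.edgeOf b) c').inv =
      (A.gluingAt ⟨b, c'⟩ ⟨v, A.fibreData.σ b v h c'⟩ (A.total_abuts_mk h c')).map
          (A.pieceVIso D v (A.fibreData.σ b v h c')).inv ≫ (A.pieceGlueIso D h c').hom := by
  rw [← cancel_epi ((A.gluingAt ⟨b, c'⟩ ⟨v, A.fibreData.σ b v h c'⟩ (A.total_abuts_mk h c')).map
    (A.pieceVIso D v (A.fibreData.σ b v h c')).hom), ← Category.assoc, A.glue_reassembled D h c',
    Category.assoc, Iso.hom_inv_id, Category.comp_id, ← Functor.map_comp_assoc, Iso.hom_inv_id,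
    CategoryTheory.Functor.map_id, Category.id_comp]

/-- `ψ^D` recovered from `pieceGlueIso`: `ψ^D = (model functor)(pieceGlueIso) ≫ counit`.
[cite: MochizukiSemiAnbd2006, Def. 2.2(i) p.23] -/
theorem ψ_eq_pieceGlueIso {b : 𝒢.graph.Branch} {v : 𝒢.graph.Vertex} (h : 𝒢.graph.abuts b = some v)
    (c' : Shrink.{u} (π₀Obj (A.T (𝒢.graph.edgeOf b)))) :
    (D.ψ ⟨b, c'⟩ ⟨v, A.fibreData.σ b v h c'⟩ (A.total_abuts_mk h c')).hom =
      (Shrink.equivalence (Over ((A.brComp ⟨b, c'⟩).1 :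
          𝒢.E (𝒢.graph.edgeOf (A.fibreData.proj.branchMap ⟨b, c'⟩))))).functor.map (A.pieceGlueIso D h c').hom ≫
        (Shrink.equivalence (Over ((A.brComp ⟨b, c'⟩).1 :
          𝒢.E (𝒢.graph.edgeOf (A.fibreData.proj.branchMap ⟨b, c'⟩))))).counitIso.hom.app
          (D.T ⟨𝒢.graph.edgeOf b, c'⟩) := by
  rw [pieceGlueIso, Iso.trans_hom, Functor.map_comp, Iso.app_hom, Functor.mapIso_hom,
    Equivalence.fun_inv_map, Category.assoc, Category.assoc, Category.assoc, Iso.inv_hom_id_app]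
  erw [Category.comp_id, Equivalence.functor_unit_comp_assoc]

/-! ### The isomorphism `toCovering A X ≅ D` -/

/-- **`toCovering A (reassembledOver D) ≅ D`.** [cite: MochizukiSemiAnbd2006, Def. 2.2(i) p.23] -/
noncomputable def reassembledIso : A.toCovering.obj (A.reassembledOver D) ≅ D :=
  BObj.isoMk
    (fun vc => ((A.toV vc).mapIso (A.pieceVIso D vc.1 vc.2)).symm ≪≫
      (Shrink.equivalence (Over ((A.vComp vc).1 : 𝒢.V (A.fibreData.proj.vertexMap vc)))).counitIso.app (D.S vc))
    (fun ec => ((A.toE ec).mapIso (A.pieceEIso D ec.1 ec.2)).symm ≪≫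
      (Shrink.equivalence (Over ((A.eComp ec).1 : 𝒢.E (A.fibreData.proj.edgeMap ec)))).counitIso.app (D.T ec))
    (fun bc vc h' => by
      obtain ⟨b, c'⟩ := bc
      obtain ⟨v, c⟩ := vc
      change A.fibreData.total.abuts ⟨b, c'⟩ = some ⟨v, c⟩ at h'
      have h₀ : 𝒢.graph.abuts b = some v := abuts_fst h'
      have hσ : A.fibreData.σ b v h₀ c' = c :=
        eq_of_heq (Sigma.mk.inj_iff.mp (Option.some_injective _ ((A.total_abuts_mk h₀ c').symm.trans h'))).2
      subst hσ
      rw [toCovering_obj_ψ_hom]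
      erw [A.ψ_eq_pieceGlueIso D h₀ c']
      -- notation: the model equivalences at the vertex `(v, σ c')` and at the branch `(b, c')`
      let eV := Shrink.equivalence (Over ((A.vComp ⟨v, A.fibreData.σ b v h₀ c'⟩).1 :
        𝒢.V (A.fibreData.proj.vertexMap ⟨v, A.fibreData.σ b v h₀ c'⟩)))
      let eQ := Shrink.equivalence (Over ((A.brComp ⟨b, c'⟩).1 :
        𝒢.E (𝒢.graph.edgeOf (A.fibreData.proj.branchMap ⟨b, c'⟩))))
      let G := A.gluingAt ⟨b, c'⟩ ⟨v, A.fibreData.σ b v h₀ c'⟩ h'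
      have hG : eQ.functor.map (A.toCoveringGlueApp ⟨b, c'⟩ ⟨v, A.fibreData.σ b v h₀ c'⟩ h' (A.reassembledOver D)).hom ≫
          eQ.functor.map (A.pieceEIso D (𝒢.graph.edgeOf b) c').inv =
          eQ.functor.map (G.map (A.pieceVIso D v (A.fibreData.σ b v h₀ c')).inv) ≫
            eQ.functor.map (A.pieceGlueIso D h₀ c').hom := by
        rw [← Functor.map_comp, ← Functor.map_comp]
        exact congrArg _ (A.glue_reassembled' D h₀ c')
      change eQ.functor.map (G.map (eV.inverse.map (eV.functor.map (A.pieceVIso D v (A.fibreData.σ b v h₀ c')).inv ≫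
          eV.counitIso.hom.app (D.S ⟨v, A.fibreData.σ b v h₀ c'⟩)))) ≫
          eQ.functor.map (A.pieceGlueIso D h₀ c').hom ≫ eQ.counitIso.hom.app (D.T ⟨𝒢.graph.edgeOf b, c'⟩) =
        (eQ.functor.map (G.map (eV.unitInv.app ((A.toCoveringV ⟨v, A.fibreData.σ b v h₀ c'⟩).obj (A.reassembledOver D)))) ≫
          eQ.functor.map (A.toCoveringGlueApp ⟨b, c'⟩ ⟨v, A.fibreData.σ b v h₀ c'⟩ h' (A.reassembledOver D)).hom) ≫
          eQ.functor.map (A.pieceEIso D (𝒢.graph.edgeOf b) c').inv ≫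
            eQ.counitIso.hom.app (D.T ⟨𝒢.graph.edgeOf b, c'⟩)
      rw [Functor.map_comp, Equivalence.inv_fun_map, Category.assoc, Category.assoc]
      erw [Equivalence.unit_inverse_comp, Category.comp_id]
      simp only [Category.assoc]
      rw [reassoc_of% hG]
      simp only [Functor.map_comp, Category.assoc])

/-- **`toCovering A` is essentially surjective.** [cite: MochizukiSemiAnbd2006, Def. 2.2(i) p.23] -/
theorem toCovering_essSurj : (A.toCovering).EssSurj :=
  ⟨fun D => ⟨A.reassembledOver D, ⟨A.reassembledIso D⟩⟩⟩

/-- **`toCovering A : B(𝒢)_{/A} ⥤ B(𝒢_A)` is an equivalence of categories** — the global clause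
"`B(𝒢)_{/A} ≃ B(𝒢')`" of [SemiAnbd] Def. 2.2 (i) for the constructed covering `𝒢' = 𝒢_A`.
[cite: MochizukiSemiAnbd2006, Def. 2.2(i) p.23] -/
theorem toCovering_isEquivalence : (A.toCovering).IsEquivalence :=
  haveI := A.toCovering_faithful
  haveI := A.toCovering_full
  haveI := A.toCovering_essSurj
  { }

end BObj

end SemiGraphOfAnabelioids

end Literature.AnabelianGeometry.SemiGraphs
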